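import Summits.QuantumFields.YangMills.Theorems.BalabanUVNodesN09AxialCovariance181OnDomainsReg8
import Summits.QuantumFields.YangMills.Theorems.BalabanUVNodesN09NestingOfHierAxial

/-!
# NODE N09 — THE ON-DOMAINS DOOR v1.2: the NESTING binder `hnestreg` and the a.e. support clause `hχreg` DERIVED as well (dag-n09-w1 g2's `…N09NestingOfHierAxial`);
# what N09's Theorem-3 member on the small-field domains still displays = [B11] Thm 1 ×3 at `θ.εbg` + the (8)-membership clause + ONE pointwise (F7a) clause + (I19)∕(H-U)
# + the two axiality CONVENTIONS (`haxDom`, `haxbg`) + [B7]-numerics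

TRACK A (YM-PLAN §2d, node N09 of 28), seat `pub-ymgap-dag-n09-w2` (D-0149 width seat 2∕4), generation g2, FILE 10.  Key of record: K1⁷ `StabilityBAtRecordR13SepCoPH` =
stmt-QuantumFields-20542; `--supports` it as a helper (Summits lane).  [I] = [Balaban1987RG1] (CMP 109), [B11] = [Balaban1985Variational] (CMP 102), [B7] =
[Balaban1985Averaging] (CMP 98).

WHY.  FILE 7 (`…OnDomainsReg8`, p596722) is dag-n09-w3's on-domains door with `hcov ∕ hsolv ∕ huniqDom` derived; dag-n24-c's 28H consumes it.  dag-n09-w1 g2's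
`…N09NestingOfHierAxial` (p598505) supplies its two remaining STRUCTURAL binders: the nesting «`Ū^{i+1}(U_k V) ∈ regSetOfRecord K i ρ_i ∩ domAltOfRecord θ.ν K (i+1)`»
(`hnestreg_of_suppPt_of_hierAxial_of_reg8` — small-field half from dag-n21-c's [B7] Prop. 2 (53) at NODE 00's averaging (a tree THEOREM) + numerics, regular-set half from
the POINTWISE (F7a) on the domains + (N29) via the two axiality conventions) and the a.e. (F7a) from its pointwise form (`hχreg_ae_of_suppPt`).  THIS FILE composes: the door's
displayed list becomes — `hreg8`, `hle`, `hεreg : 0 ≤ θ.ν.εreg`; `haxDom` ((2.3)'s axial convention for the record's critical configuration on `domAlt_{j+1}`); `haxbg` (hierarchical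
block-axiality of the partial averages `Ū^j(U_k V)` of the record's radius-`θ.εbg` background of a small field — the property a hierarchically rooted∕axial selection has by
construction); the POINTWISE (F7a) clause `hχregpt` (K0e's analytic debt on regular fields); (I19) `hint` (or (H-U) `hU`); [B11] Thm 1 ×3 at `θ.εbg` (`h11 ∕ hres ∕ huniq`, N07);
the [B7]-numerics `0 < θ.εbg`, `143·((d+4)²∕4)²·θ.εbg ≤ ⅓`, `2θ.εbg ≤ 2δ_N∕((d+4)L)²`, `2θ.εbg ≤ θ.ν.ε₀·L²`, and `0 < θ.ε₂₉`.  NO covariance, NO χ-invariance, NO nesting, NO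
HERED, NO solvability-at-`εreg` binder remains.
* ★★★★ `thm3Member_forall_stage13SepCoPH_onDomains_of_axialOn_of_reg8_of_suppPt` — FILE 7's door fed by dag-n09-w1 g2's two letters; `…_of_measurableUk` twin ((I19) ↦ (H-U));
  `b12_main_forall_…` corollary with N09's own leaf.
LOCATED (not settled here; dag-n09-w1 g2's reading, confirmed): at the V18 witness `θ₁₃ᶜᶜᴹᵂ` (`εbg = 1`) `hreg8`, `h11` and the [B7]-numerics on `εbg` are OUTSIDE print's regime
(`C₀(4)·1 ≤ ⅓` is false) — the one-token `εbg := a₀` puts the witness inside; the two axiality conventions are definitional after node00-def's re-points (dag-n09-w4's `UkSel` kit ∕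
this seat's FILES 5–9); (F7a) pointwise and (I19) are K0e's ∕ def-T's analytic content; [B11] ×3 is N07's.

HONEST FRAMING: count-neutral composition BY NAME (FILE 7, dag-n09-w1 g2's nesting supplier, dag-n09-w3's door, dag-n21-c's [B7] Prop. 2 theorem, dag-n24-c's junction);
NOTHING of Bałaban's asserted beyond the tree theorems cited; N09 NOT discharged; K0⁷ ∕ K1⁷ OPEN; counts unmoved (typed 28∕28 · discharged 5∕27); R4 is the conditional
finite-𝕋⁴ rung `BalabanLadder.UV` only — NOT continuum ∕ ℝ⁴ ∕ OS ∕ mass gap ∕ Clay.  THEOREMS ONLY (0 `def`, 0 `sorry`), standard axioms.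
-/

noncomputable section

namespace Summit.QuantumFields.YangMills.BalabanUVNodes.N09AxialCovariance181OnDomainsReg8Nesting

open MeasureTheory
open Literature.MathematicalPhysics.QuantumFieldTheory.Balaban1983to89
open Literature.MathematicalPhysics.QuantumFieldTheory.Balaban1983to89.Node00
open B12RTGaugeInvariance254 (liftTransf)
open ExpMeanLog (deltaSU)
open B12NodeKnitRecord8 (b12_main_of_leaf_of_thm3Member)
open DagBinding
open GaugeField (gaugeAct)
open Summit.QuantumFields.YangMills.BalabanUVNodes.N09AxialCovariance181OnDomainsReg8 (thm3Member_forall_stage13SepCoPH_onDomains_of_axialOn_of_reg8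
  thm3Member_forall_stage13SepCoPH_onDomains_of_axialOn_of_reg8_of_measurableUk)
open Summit.QuantumFields.YangMills.BalabanUVNodes.N09NestingOfHierAxial (hχreg_ae_of_suppPt hnestreg_of_suppPt_of_hierAxial_of_reg8)

variable {F : T4Continuum.T4Family} {N : ℕ} [NeZero N]

/-- ★★★★ **N24's `h09T` AT A WORLD BOUND TO THE STAGE-13 v1.7 CONSTRUCTION, ON THE SMALL-FIELD DOMAINS — door v1.2: NO covariance, NO χ-invariance, NO nesting, NO HERED, NO
`εreg`-solvability binder**: FILE 7's `thm3Member_forall_stage13SepCoPH_onDomains_of_axialOn_of_reg8` with `hχreg` ↦ dag-n09-w1 g2's `hχreg_ae_of_suppPt` (from the pointwise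
(F7a) `hχregpt`) and `hnestreg` ↦ `hnestreg_of_suppPt_of_hierAxial_of_reg8` (from `hχregpt`, `h11`.1, `hres`, `huniq`, `hreg8`, `hle`, `hεreg`, `haxbg`, `haxDom` and the
[B7]-numerics).  Displayed: `hreg8`, `hle`, `hεreg`, `haxDom`, `haxbg`, `hχregpt`, (I19) `hint`, [B11] ×3 at `θ.εbg`, `0 < θ.ε₂₉`, `0 < θ.εbg`, `143·((d+4)²∕4)²·θ.εbg ≤ ⅓`,
`2θ.εbg ≤ 2δ_N∕((d+4)L)²`, `2θ.εbg ≤ θ.ν.ε₀·L²`.  CONDITIONAL on every displayed hypothesis; nothing of Bałaban asserted beyond the tree theorems cited; N09 NOT discharged; K1⁷ NOT closed.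
[cite: Balaban1987RG1, Thm 3 p.264, (1.1)–(1.3) p.260, (2.1)–(2.3) p.265, (2.9)–(2.10) pp.266–267; Balaban1985Variational, Thm 1 (6), (8)–(10) p.279 and (181) p.307; Balaban1985Averaging, Prop. 2 (53) p.26] -/
theorem thm3Member_forall_stage13SepCoPH_onDomains_of_axialOn_of_reg8_of_suppPt (θ : Stage13HParams F N) (h : θ.Provisos₁₃SepCoPH F N) {w : WorldP}
    (hC : w.C = (datumOfRecord₁₃SepCoPH F N θ h).C) (cd : (P : B12.RunParams) → (j : ℕ) → ContourData (F.P P.K) j (SU N))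
    (hreg8 : ∀ (P : B12.RunParams) (k : ℕ), k ≤ P.K → ∀ V ∈ domAltOfRecord F N θ.ν P.K k, Uk F N P.K k θ.εbg V ∈ bgReg F N P.K k θ.ν.εreg)
    (hle : θ.ν.εreg ≤ θ.εbg) (hεreg : 0 ≤ θ.ν.εreg)
    (haxDom : ∀ (P : B12.RunParams), ∀ j < P.K, ∀ W ∈ domAltOfRecord F N θ.ν P.K (j + 1), AxialGauge (cd P j) (critCfgOfRecord F N θ.ν P.K j W))
    (haxbg : ∀ (P : B12.RunParams) (k : ℕ), k ≤ P.K → ∀ V ∈ domAltOfRecord F N θ.ν P.K k, ∀ j < k,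
      AxialGauge (cd P j) (Averaging.iter (avOfRecord F N P.K) j (Uk F N P.K k θ.εbg V)))
    (hχregpt : ∀ (P : B12.RunParams) (i : ℕ), i + 1 < P.K → ∀ U : GaugeField (F.P P.K) (i + 1) (SU N),
      (avOfRecord F N P.K (i + 1)).avg U ∈ domAltOfRecord F N θ.ν P.K (i + 2) →
        U ∉ regSetOfRecord F N P.K i (betaInputOfRecord F N (TβOfRecord₁₃ F N) (chiβOfRecord₁₃ F N θ.toStage13Params) P.K (gOfRecord₁₃ F N θ.toStage13Params P) i) ∩
            domAltOfRecord F N θ.ν P.K (i + 1) →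
          chiβOfRecord₁₃ F N θ.toStage13Params P.K (gOfRecord₁₃ F N θ.toStage13Params P) (i + 1) U = 0)
    (hint : ∀ (P : B12.RunParams), ∀ j < P.K, Integrable (betaInputOfRecord F N (TβOfRecord₁₃ F N) (chiβOfRecord₁₃ F N θ.toStage13Params) P.K
      (gOfRecord₁₃ F N θ.toStage13Params P) j) (fieldMeasure (F.P P.K) j (SU N)))
    (h11 : ∀ (P : B12.RunParams) (k : ℕ), k ≤ P.K → ∀ V ∈ domAltOfRecord F N θ.ν P.K k, UkExists F N P.K k θ.εbg V ∧ UniqueUkOrbit F N P.K k θ.εbg V)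
    (hres : ∀ (P : B12.RunParams) (k : ℕ), k ≤ P.K → HRestrict F N θ.εbg P.K k (domAltOfRecord F N θ.ν P.K k))
    (huniq : ∀ (P : B12.RunParams) (k : ℕ), k ≤ P.K → ∀ V ∈ domAltOfRecord F N θ.ν P.K k, ∀ j < k,
      UniqueUkOrbit F N P.K (j + 1) θ.εbg (Averaging.iter (avOfRecord F N P.K) (j + 1) (Uk F N P.K k θ.εbg V)))
    (hεχ : 0 < θ.ε₂₉) (hε : 0 < θ.εbg)
    (hε3 : ∀ P : B12.RunParams, (143 * (((((F.P P.K).d + 4 : ℕ) : ℝ)) ^ 2 / 4) ^ 2) * θ.εbg ≤ 1 / 3)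
    (hε2 : ∀ P : B12.RunParams, 2 * θ.εbg ≤ 2 * deltaSU (Fin N) / ((((F.P P.K).d + 4) * (F.P P.K).L : ℕ) : ℝ) ^ 2)
    (hε₀ : ∀ P : B12.RunParams, 2 * θ.εbg ≤ θ.ν.ε₀ * ((F.P P.K).L : ℝ) ^ 2) :
    ∀ P : B12.RunParams, (leavesP w P).smallCouplings → (leavesP w P).smallFieldInductive :=
  thm3Member_forall_stage13SepCoPH_onDomains_of_axialOn_of_reg8 θ h hC cd hreg8 hle haxDom
    (fun P => hχreg_ae_of_suppPt θ.toStage13Params P (hχregpt P)) hint h11 hres huniq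
    (fun P => hnestreg_of_suppPt_of_hierAxial_of_reg8 θ.toStage13Params hεχ P (cd P) (hχregpt P) (fun k hk V hV => (h11 P k hk V hV).1)
      (hres P) (huniq P) (hreg8 P) hle hεreg (haxbg P) (haxDom P) hε (hε3 P) (hε2 P) (hε₀ P))

/-- **THE SAME WITH (I19) REPLACED BY (H-U)** (measurability of the level-`(k+1)` minimiser selection at radius `θ.ν.εreg`).  CONDITIONAL; N09 NOT discharged; K1⁷ NOT closed.
[cite: Balaban1987RG1, Thm 3 p.264, (0.19) p.255, (2.1)–(2.3) p.265; Balaban1985Variational, Thm 1 (8) p.279; Balaban1985Averaging, Prop. 2 (53) p.26] -/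
theorem thm3Member_forall_stage13SepCoPH_onDomains_of_axialOn_of_reg8_of_suppPt_of_measurableUk (θ : Stage13HParams F N) (h : θ.Provisos₁₃SepCoPH F N) {w : WorldP}
    (hC : w.C = (datumOfRecord₁₃SepCoPH F N θ h).C) (cd : (P : B12.RunParams) → (j : ℕ) → ContourData (F.P P.K) j (SU N))
    (hreg8 : ∀ (P : B12.RunParams) (k : ℕ), k ≤ P.K → ∀ V ∈ domAltOfRecord F N θ.ν P.K k, Uk F N P.K k θ.εbg V ∈ bgReg F N P.K k θ.ν.εreg)
    (hle : θ.ν.εreg ≤ θ.εbg) (hεreg : 0 ≤ θ.ν.εreg)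
    (haxDom : ∀ (P : B12.RunParams), ∀ j < P.K, ∀ W ∈ domAltOfRecord F N θ.ν P.K (j + 1), AxialGauge (cd P j) (critCfgOfRecord F N θ.ν P.K j W))
    (haxbg : ∀ (P : B12.RunParams) (k : ℕ), k ≤ P.K → ∀ V ∈ domAltOfRecord F N θ.ν P.K k, ∀ j < k,
      AxialGauge (cd P j) (Averaging.iter (avOfRecord F N P.K) j (Uk F N P.K k θ.εbg V)))
    (hχregpt : ∀ (P : B12.RunParams) (i : ℕ), i + 1 < P.K → ∀ U : GaugeField (F.P P.K) (i + 1) (SU N),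
      (avOfRecord F N P.K (i + 1)).avg U ∈ domAltOfRecord F N θ.ν P.K (i + 2) →
        U ∉ regSetOfRecord F N P.K i (betaInputOfRecord F N (TβOfRecord₁₃ F N) (chiβOfRecord₁₃ F N θ.toStage13Params) P.K (gOfRecord₁₃ F N θ.toStage13Params P) i) ∩
            domAltOfRecord F N θ.ν P.K (i + 1) →
          chiβOfRecord₁₃ F N θ.toStage13Params P.K (gOfRecord₁₃ F N θ.toStage13Params P) (i + 1) U = 0)
    (hU : ∀ (P : B12.RunParams) (k : ℕ), k < P.K → Measurable (Uk F N P.K (k + 1) θ.ν.εreg))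
    (h11 : ∀ (P : B12.RunParams) (k : ℕ), k ≤ P.K → ∀ V ∈ domAltOfRecord F N θ.ν P.K k, UkExists F N P.K k θ.εbg V ∧ UniqueUkOrbit F N P.K k θ.εbg V)
    (hres : ∀ (P : B12.RunParams) (k : ℕ), k ≤ P.K → HRestrict F N θ.εbg P.K k (domAltOfRecord F N θ.ν P.K k))
    (huniq : ∀ (P : B12.RunParams) (k : ℕ), k ≤ P.K → ∀ V ∈ domAltOfRecord F N θ.ν P.K k, ∀ j < k,
      UniqueUkOrbit F N P.K (j + 1) θ.εbg (Averaging.iter (avOfRecord F N P.K) (j + 1) (Uk F N P.K k θ.εbg V)))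
    (hεχ : 0 < θ.ε₂₉) (hε : 0 < θ.εbg)
    (hε3 : ∀ P : B12.RunParams, (143 * (((((F.P P.K).d + 4 : ℕ) : ℝ)) ^ 2 / 4) ^ 2) * θ.εbg ≤ 1 / 3)
    (hε2 : ∀ P : B12.RunParams, 2 * θ.εbg ≤ 2 * deltaSU (Fin N) / ((((F.P P.K).d + 4) * (F.P P.K).L : ℕ) : ℝ) ^ 2)
    (hε₀ : ∀ P : B12.RunParams, 2 * θ.εbg ≤ θ.ν.ε₀ * ((F.P P.K).L : ℝ) ^ 2) :
    ∀ P : B12.RunParams, (leavesP w P).smallCouplings → (leavesP w P).smallFieldInductive :=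
  thm3Member_forall_stage13SepCoPH_onDomains_of_axialOn_of_reg8_of_measurableUk θ h hC cd hreg8 hle haxDom hU
    (fun P => hχreg_ae_of_suppPt θ.toStage13Params P (hχregpt P)) h11 hres huniq
    (fun P => hnestreg_of_suppPt_of_hierAxial_of_reg8 θ.toStage13Params hεχ P (cd P) (hχregpt P) (fun k hk V hV => (h11 P k hk V hV).1)
      (hres P) (huniq P) (hreg8 P) hle hεreg (haxbg P) (haxDom P) hε (hε3 P) (hε2 P) (hε₀ P))

/-- **N09 = `Dag.B12_main` AT EVERY RUN OF A WORLD BOUND TO THE STAGE-13 v1.7 CONSTRUCTION**, door v1.2, from N09's own leaf `b12` ([I] Lemma 4) (dag-n09-a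
`b12_main_of_leaf_of_thm3Member`).  CONDITIONAL; N09 NOT discharged. [cite: Balaban1987RG1, Lemma 4 (3.53) p.280, Thm 3 p.264 and (2.3) p.265; Balaban1985Variational, Thm 1 (8) p.279] -/
theorem b12_main_forall_stage13SepCoPH_onDomains_of_axialOn_of_reg8_of_suppPt (θ : Stage13HParams F N) (h : θ.Provisos₁₃SepCoPH F N) {w : WorldP}
    (hC : w.C = (datumOfRecord₁₃SepCoPH F N θ h).C) (h12 : ∀ P : B12.RunParams, (leavesP w P).b12)
    (cd : (P : B12.RunParams) → (j : ℕ) → ContourData (F.P P.K) j (SU N))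
    (hreg8 : ∀ (P : B12.RunParams) (k : ℕ), k ≤ P.K → ∀ V ∈ domAltOfRecord F N θ.ν P.K k, Uk F N P.K k θ.εbg V ∈ bgReg F N P.K k θ.ν.εreg)
    (hle : θ.ν.εreg ≤ θ.εbg) (hεreg : 0 ≤ θ.ν.εreg)
    (haxDom : ∀ (P : B12.RunParams), ∀ j < P.K, ∀ W ∈ domAltOfRecord F N θ.ν P.K (j + 1), AxialGauge (cd P j) (critCfgOfRecord F N θ.ν P.K j W))
    (haxbg : ∀ (P : B12.RunParams) (k : ℕ), k ≤ P.K → ∀ V ∈ domAltOfRecord F N θ.ν P.K k, ∀ j < k,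
      AxialGauge (cd P j) (Averaging.iter (avOfRecord F N P.K) j (Uk F N P.K k θ.εbg V)))
    (hχregpt : ∀ (P : B12.RunParams) (i : ℕ), i + 1 < P.K → ∀ U : GaugeField (F.P P.K) (i + 1) (SU N),
      (avOfRecord F N P.K (i + 1)).avg U ∈ domAltOfRecord F N θ.ν P.K (i + 2) →
        U ∉ regSetOfRecord F N P.K i (betaInputOfRecord F N (TβOfRecord₁₃ F N) (chiβOfRecord₁₃ F N θ.toStage13Params) P.K (gOfRecord₁₃ F N θ.toStage13Params P) i) ∩
            domAltOfRecord F N θ.ν P.K (i + 1) →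
          chiβOfRecord₁₃ F N θ.toStage13Params P.K (gOfRecord₁₃ F N θ.toStage13Params P) (i + 1) U = 0)
    (hint : ∀ (P : B12.RunParams), ∀ j < P.K, Integrable (betaInputOfRecord F N (TβOfRecord₁₃ F N) (chiβOfRecord₁₃ F N θ.toStage13Params) P.K
      (gOfRecord₁₃ F N θ.toStage13Params P) j) (fieldMeasure (F.P P.K) j (SU N)))
    (h11 : ∀ (P : B12.RunParams) (k : ℕ), k ≤ P.K → ∀ V ∈ domAltOfRecord F N θ.ν P.K k, UkExists F N P.K k θ.εbg V ∧ UniqueUkOrbit F N P.K k θ.εbg V)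
    (hres : ∀ (P : B12.RunParams) (k : ℕ), k ≤ P.K → HRestrict F N θ.εbg P.K k (domAltOfRecord F N θ.ν P.K k))
    (huniq : ∀ (P : B12.RunParams) (k : ℕ), k ≤ P.K → ∀ V ∈ domAltOfRecord F N θ.ν P.K k, ∀ j < k,
      UniqueUkOrbit F N P.K (j + 1) θ.εbg (Averaging.iter (avOfRecord F N P.K) (j + 1) (Uk F N P.K k θ.εbg V)))
    (hεχ : 0 < θ.ε₂₉) (hε : 0 < θ.εbg)
    (hε3 : ∀ P : B12.RunParams, (143 * (((((F.P P.K).d + 4 : ℕ) : ℝ)) ^ 2 / 4) ^ 2) * θ.εbg ≤ 1 / 3)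
    (hε2 : ∀ P : B12.RunParams, 2 * θ.εbg ≤ 2 * deltaSU (Fin N) / ((((F.P P.K).d + 4) * (F.P P.K).L : ℕ) : ℝ) ^ 2)
    (hε₀ : ∀ P : B12.RunParams, 2 * θ.εbg ≤ θ.ν.ε₀ * ((F.P P.K).L : ℝ) ^ 2) :
    ∀ P : B12.RunParams, Dag.B12_main (leavesP w P) :=
  fun P => b12_main_of_leaf_of_thm3Member (h12 P)
    (thm3Member_forall_stage13SepCoPH_onDomains_of_axialOn_of_reg8_of_suppPt θ h hC cd hreg8 hle hεreg haxDom haxbg hχregpt hint h11 hres huniq hεχ hε hε3 hε2 hε₀ P)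

end Summit.QuantumFields.YangMills.BalabanUVNodes.N09AxialCovariance181OnDomainsReg8Nesting
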